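import Summits.AtomisticToContinuum.HydrodynamicLimit.Theses.AntiMazurCoboundaries
import Literature.Analysis.FluidPDE.HardSphereAlexander
import Literature.Analysis.UnboundedOperators.LinearizedBoltzmannDirichletFormProofs

/-!
# `BoltzmannGreenKubo` for EVERY `N` (no `N₀`) is FALSE (refuted natural strengthening)

Negative knowledge for the crux `AntiMazurCoboundaries.BoltzmannGreenKubo` (stmt-AtomisticToContinuum-13985, the
dilute-corner Green–Kubo rung), from the standing disprover's `Cruxes/BoltzmannGreenKubo/Disproof.lean` §2:
`BoltzmannGreenKuboForallN` is the crux VERBATIM with `∃ N₀, ∀ N ≥ N₀` strengthened to `∀ N`, and it is FALSE.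
Witness `N = 0`: a hard-sphere flow of ONE sphere is free flight on its good set (`flow_vel_eq`), so for `φ ≡ 1`
and the bounded smooth observable `g_B(w) = w₀w₁/(1+|w|²)` (`γ`-orthogonal to `span(1, v, |v|²)` by invariance of
the standard Gaussian under the coordinate reflections, `gB_orth`) the kinetic-window functional is the static
moment `X = E_{G₀}[g_B²]`, independent of the window (`window_N0`), while
`D = dirichletFormInv hardSphereLinearizedOp g_B > 0` by the tree's proved spectral gap
(`dirichletFormInv_pos_of_orthogonal_of_ne_zero_holds`); the statement at `η = D/2`, windows `s₀` and `2s₀` and a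
common `σ` forces `s₀X ≥ 3D/2` and `2s₀X ≤ 5D/2`, absurd. Hence `N₀` is load-bearing: any proof of the crux must
let `N → ∞` before `σ → 0` and `s → ∞` (at fixed `N` the finite system carries `O(1/N)` Drude weights of the
non-linear conserved charges, and at `N = 0` the full static variance). The lemmas `gB`, `gB_orth`,
`gB_mem_temperateGrowth`, `dirichletFormInv_gB_pos` also give provers a ready-made non-trivial instance of the
crux's hypotheses with `D(g) > 0`.
refuter-cdisprove-stmt-AtomisticToContinuum-13985-0.
-/

noncomputable section

namespace Summit.AtomisticToContinuum.HydrodynamicLimit.Theorems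

open MeasureTheory ProbabilityTheory
open Literature.Analysis.FluidPDE Literature.MathematicalPhysics.KineticTheory
open Literature.Analysis.UnboundedOperators
open scoped InnerProductSpace

namespace BoltzmannGreenKuboForallN

/-! ### A bounded smooth test observable orthogonal to the collision invariants -/

/-- `g_B(w) = w₀ w₁ / (1 + |w|²)`: bounded by `1`, smooth of temperate growth, odd under each of the
coordinate reflections `w₀ ↦ -w₀`, `w₁ ↦ -w₁`, hence `γ`-orthogonal to `span(1, v, |v|²)`. [folklore] -/
def gB (w : V3) : ℝ := w 0 * w 1 * (1 + ‖w‖ ^ 2)⁻¹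

/-- Unfolding lemma for `g_B`. [folklore] -/
theorem gB_apply (w : V3) : gB w = w 0 * w 1 * (1 + ‖w‖ ^ 2)⁻¹ := rfl

/-- `1 + |w|² > 0`. [folklore] -/
theorem one_add_norm_sq_pos (w : V3) : 0 < 1 + ‖w‖ ^ 2 := by positivity

/-- `|w|² = w₀² + w₁² + w₂²` on `ℝ³`. [folklore] -/
theorem norm_sq_eq_three (w : V3) : ‖w‖ ^ 2 = w 0 ^ 2 + w 1 ^ 2 + w 2 ^ 2 := by
  rw [EuclideanSpace.real_norm_sq_eq, Fin.sum_univ_three]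

/-- `|g_B| ≤ 1`. [folklore] -/
theorem abs_gB_le (w : V3) : |gB w| ≤ 1 := by
  have hpos := one_add_norm_sq_pos w
  have hn := norm_sq_eq_three w
  rw [gB_apply, abs_mul, abs_inv, abs_of_pos hpos, ← div_eq_mul_inv, div_le_one hpos, abs_mul]
  nlinarith [sq_abs (w 0), sq_abs (w 1), sq_nonneg (|w 0| - |w 1|), sq_nonneg (w 2),
    abs_nonneg (w 0), abs_nonneg (w 1)]

/-- `g_B` is continuous. [folklore] -/
theorem continuous_gB : Continuous gB := by
  have h0 : Continuous fun w : V3 => w 0 := (EuclideanSpace.proj (𝕜 := ℝ) (0 : Fin 3)).continuous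
  have h1 : Continuous fun w : V3 => w 1 := (EuclideanSpace.proj (𝕜 := ℝ) (1 : Fin 3)).continuous
  have h2 : Continuous fun w : V3 => (1 + ‖w‖ ^ 2)⁻¹ :=
    (continuous_const.add (continuous_norm.pow 2)).inv₀ fun w => (one_add_norm_sq_pos w).ne'
  exact (h0.mul h1).mul h2

/-- `g_B` has temperate growth (so the tree's Dirichlet-form facts apply to it). [folklore] -/
theorem gB_mem_temperateGrowth : gB ∈ temperateGrowth V3 := by
  rw [mem_temperateGrowth_iff]
  have h0 : Function.HasTemperateGrowth fun w : V3 => w 0 :=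
    (EuclideanSpace.proj (𝕜 := ℝ) (0 : Fin 3)).hasTemperateGrowth
  have h1 : Function.HasTemperateGrowth fun w : V3 => w 1 :=
    (EuclideanSpace.proj (𝕜 := ℝ) (1 : Fin 3)).hasTemperateGrowth
  have h3 : Function.HasTemperateGrowth fun w : V3 => (1 + ‖w‖ ^ 2) ^ (-1 : ℝ) :=
    Function.hasTemperateGrowth_one_add_norm_sq_rpow V3 (-1)
  have h2 : Function.HasTemperateGrowth fun w : V3 => (1 + ‖w‖ ^ 2)⁻¹ := by
    have e : (fun w : V3 => (1 + ‖w‖ ^ 2)⁻¹) = fun w => (1 + ‖w‖ ^ 2) ^ (-1 : ℝ) :=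
      funext fun w => (Real.rpow_neg_one _).symm
    rw [e]
    exact h3
  exact (h0.mul h1).mul h2

/-- `g_B ≠ 0` (its value at `(1,1,1)` is `1/4`). [folklore] -/
theorem gB_ne_zero : gB ≠ 0 := by
  intro h
  have h1 := congrFun h (WithLp.toLp 2 fun _ : Fin 3 => (1 : ℝ))
  have hn : ‖(WithLp.toLp 2 fun _ : Fin 3 => (1 : ℝ) : V3)‖ ^ 2 = 3 := by
    rw [norm_sq_eq_three]
    norm_num
  rw [gB_apply, hn] at h1
  simp only [Pi.zero_apply] at h1
  norm_num at h1

/-- The coordinate reflection `w_k ↦ -w_k` as a linear isometry of `ℝ³`. [folklore] -/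
def reflB (k : Fin 3) : V3 ≃ₗᵢ[ℝ] V3 :=
  LinearIsometryEquiv.piLpCongrRight 2 fun i =>
    if i = k then LinearIsometryEquiv.neg ℝ (E := ℝ) else LinearIsometryEquiv.refl ℝ ℝ

/-- Coordinates of the reflected vector. [folklore] -/
theorem reflB_apply (k : Fin 3) (w : V3) (i : Fin 3) :
    reflB k w i = if i = k then -w i else w i := by
  unfold reflB
  rw [LinearIsometryEquiv.piLpCongrRight_apply, PiLp.toLp_apply]
  split_ifs <;> simp

/-- A `γ`-integral of a function odd under a linear isometry vanishes (the standard Gaussian is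
invariant under linear isometries, `stdGaussian_map`). [folklore] -/
theorem integral_stdGaussian_eq_zero_of_odd (R : V3 ≃ₗᵢ[ℝ] V3) {G : V3 → ℝ}
    (hG : ∀ w, G (R w) = -G w) : ∫ w, G w ∂stdGaussian V3 = 0 := by
  have hmp : MeasurePreserving R (stdGaussian V3) (stdGaussian V3) :=
    ⟨R.continuous.measurable, stdGaussian_map R⟩
  have h1 : ∫ w, G (R w) ∂stdGaussian V3 = ∫ w, G w ∂stdGaussian V3 :=
    hmp.integral_comp R.toHomeomorph.measurableEmbedding G
  simp only [hG, integral_neg] at h1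
  linarith

/-- `g_B` is odd under `w₀ ↦ -w₀`. [folklore] -/
theorem gB_reflB_zero (w : V3) : gB (reflB 0 w) = -gB w := by
  simp only [gB_apply, reflB_apply, LinearIsometryEquiv.norm_map]
  simp

/-- `g_B` is odd under `w₁ ↦ -w₁`. [folklore] -/
theorem gB_reflB_one (w : V3) : gB (reflB 1 w) = -gB w := by
  simp only [gB_apply, reflB_apply, LinearIsometryEquiv.norm_map]
  simp

/-- The inner product of `ℝ³` in coordinates. [folklore] -/
theorem inner_eq_three (b v : V3) : ⟪b, v⟫_ℝ = b 0 * v 0 + b 1 * v 1 + b 2 * v 2 := by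
  simp [PiLp.inner_apply, Fin.sum_univ_three, mul_comm]

/-- **`g_B ⊥ span(1, v, |v|²)` in `L²(γ)`**, in the exact form of the crux's hypothesis. [folklore] -/
theorem gB_orth (c₀ c₂ : ℝ) (b : V3) :
    ∫ v, gB v * (c₀ + ⟪b, v⟫_ℝ + c₂ * ‖v‖ ^ 2) ∂stdGaussian V3 = 0 := by
  set pa : V3 → ℝ := fun v => c₀ + (b 1 * v 1 + b 2 * v 2) + c₂ * ‖v‖ ^ 2 with hpa
  set pb : V3 → ℝ := fun v => b 0 * v 0 with hpb
  have hsplit : (fun v => gB v * (c₀ + ⟪b, v⟫_ℝ + c₂ * ‖v‖ ^ 2)) =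
      fun v => gB v * pa v + gB v * pb v := by
    funext v
    simp only [inner_eq_three, hpa, hpb]
    ring
  have h0 : Function.HasTemperateGrowth fun w : V3 => w 0 :=
    (EuclideanSpace.proj (𝕜 := ℝ) (0 : Fin 3)).hasTemperateGrowth
  have h1 : Function.HasTemperateGrowth fun w : V3 => w 1 :=
    (EuclideanSpace.proj (𝕜 := ℝ) (1 : Fin 3)).hasTemperateGrowth
  have h2 : Function.HasTemperateGrowth fun w : V3 => w 2 :=
    (EuclideanSpace.proj (𝕜 := ℝ) (2 : Fin 3)).hasTemperateGrowth
  have hpa_t : pa ∈ temperateGrowth V3 := by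
    rw [mem_temperateGrowth_iff, hpa]
    exact ((Function.HasTemperateGrowth.const c₀).add
      (((Function.HasTemperateGrowth.const _).mul h1).add
        ((Function.HasTemperateGrowth.const _).mul h2))).add
      ((Function.HasTemperateGrowth.const c₂).mul (Function.hasTemperateGrowth_norm_sq V3))
  have hpb_t : pb ∈ temperateGrowth V3 := by
    rw [mem_temperateGrowth_iff, hpb]
    exact (Function.HasTemperateGrowth.const _).mul h0
  have hia : Integrable (fun v => gB v * pa v) (stdGaussian V3) :=
    integrable_mul_stdGaussian gB_mem_temperateGrowth hpa_t
  have hib : Integrable (fun v => gB v * pb v) (stdGaussian V3) :=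
    integrable_mul_stdGaussian gB_mem_temperateGrowth hpb_t
  rw [hsplit, integral_add hia hib,
    integral_stdGaussian_eq_zero_of_odd (reflB 0) (G := fun v => gB v * pa v),
    integral_stdGaussian_eq_zero_of_odd (reflB 1) (G := fun v => gB v * pb v), add_zero]
  · intro w
    simp only [hpb, gB_reflB_one, reflB_apply]
    simp
  · intro w
    simp only [hpa, gB_reflB_zero, reflB_apply, LinearIsometryEquiv.norm_map]
    simp

/-- `g_B ⊥` the tree's `collisionInvariants`. [folklore] -/
theorem gB_orth' : ∀ φ ∈ collisionInvariants V3, maxwellianInner gB φ = 0 := by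
  intro φ hφ
  obtain ⟨a, c, b, rfl⟩ := mem_collisionInvariants_iff.1 hφ
  simp only [maxwellianInner]
  exact gB_orth a c b

/-- `D(g_B) = dirichletFormInv L g_B > 0` (tree: spectral gap ⇒ positivity of the Dirichlet form of the
pseudo-inverse on non-zero orthogonal temperate functions). [folklore] -/
theorem dirichletFormInv_gB_pos : 0 < dirichletFormInv (hardSphereLinearizedOp (E := V3)) gB := by
  have hE : 2 ≤ Module.finrank ℝ V3 := by
    rw [finrank_euclideanSpace, Fintype.card_fin]
    norm_num
  exact dirichletFormInv_pos_of_orthogonal_of_ne_zero_holds (E := V3) hE gB_mem_temperateGrowth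
    gB_orth' gB_ne_zero

/-! ### One particle never collides -/

/-- A hard-sphere flow of ONE particle is free flight on its good set: velocities are constant. [folklore] -/
theorem flow_vel_eq {ε : ℝ} (Φ : HardSphereFlow (Torus.geometry (Fin 3)) ε (0 + 1))
    {z : Config (0 + 1) (Fin 3) T3} (hz : z ∈ Φ.good) {r : ℝ} (hr : 0 ≤ r) (i : Fin (0 + 1)) :
    (Φ.flow r z i).2 = (z i).2 := by
  have htraj := Φ.isTrajectory z hz
  have hno : ∀ τ : ℝ, τ ∉ collisionTimes (Torus.geometry (Fin 3)) ε (fun t => Φ.flow t z) := by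
    intro τ hτ
    obtain ⟨j, k, hjk, -⟩ := hτ
    exact hjk (Fin.ext (by have := j.isLt; have := k.isLt; omega))
  have hfree := htraj.free 0 r hr (fun τ _ => hno τ)
  rw [Φ.flow_zero z hz, sub_zero] at hfree
  rw [hfree, freeFlight_apply]

/-- For `N = 0` the kinetic-window functional of any velocity observable is its STATIC second moment:
`∫ ofReal((h⁻¹∫₀ʰ Σᵢ 1·G(vᵢ(r)) dr)²) dG₀ = ∫ ofReal((Σᵢ 1·G(vᵢ))²) dG₀` (a.e. `z` is good, and there the
velocity is constant). [folklore] -/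
theorem window_N0 {σ : ℝ} (Φ : HardSphereFlow (Torus.geometry (Fin 3)) (hsDiameter σ 0) (0 + 1))
    {h : ℝ} (hh : 0 < h) (G : V3 → ℝ) :
    ∫⁻ z, ENNReal.ofReal ((h⁻¹ * ∫ r in (0 : ℝ)..h, ∑ i, (1 : ℝ) * G ((Φ.flow r z i).2)) ^ 2)
        ∂(localGibbsLaw σ (fun _ => 1) (fun _ => 0) (fun _ => 1) 0 Φ) =
      ∫⁻ z, ENNReal.ofReal ((∑ i, (1 : ℝ) * G ((z i).2)) ^ 2)
        ∂(localGibbsLaw σ (fun _ => 1) (fun _ => 0) (fun _ => 1) 0 Φ) := by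
  have hgood : ∀ᵐ z ∂(localGibbsLaw σ (fun _ => 1) (fun _ => 0) (fun _ => 1) 0 Φ), z ∈ Φ.good := by
    unfold localGibbsLaw
    rw [particleLaw_eq]
    exact (withDensity_absolutelyContinuous _ _).ae_le Φ.ae_mem_good
  refine lintegral_congr_ae ?_
  filter_upwards [hgood] with z hz
  have hint : ∫ r in (0 : ℝ)..h, ∑ i, (1 : ℝ) * G ((Φ.flow r z i).2) =
      ∫ r in (0 : ℝ)..h, ∑ i, (1 : ℝ) * G ((z i).2) := by
    refine intervalIntegral.integral_congr fun r hr => ?_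
    rw [Set.uIcc_of_le hh.le] at hr
    refine Finset.sum_congr rfl fun i _ => ?_
    rw [flow_vel_eq Φ hz hr.1 i]
  have hA : h⁻¹ * ∫ r in (0 : ℝ)..h, ∑ i, (1 : ℝ) * G ((Φ.flow r z i).2) = ∑ i, (1 : ℝ) * G ((z i).2) := by
    rw [hint, intervalIntegral.integral_const, smul_eq_mul, sub_zero, ← mul_assoc,
      inv_mul_cancel₀ hh.ne', one_mul]
  rw [hA]

end BoltzmannGreenKuboForallN

open BoltzmannGreenKuboForallN

/-! ### The strengthening without `N₀` -/

/-- `BoltzmannGreenKubo` with `∃ N₀, ∀ N ≥ N₀` strengthened to `∀ N` (everything else verbatim). -/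
def BoltzmannGreenKuboForallN : Prop :=
  ∀ (a θ : ℝ) (u₀ : Literature.MathematicalPhysics.KineticTheory.V3), 0 < a → 0 < θ → ∀ (φ : Literature.MathematicalPhysics.KineticTheory.T3 → ℝ) (g : Literature.MathematicalPhysics.KineticTheory.V3 → ℝ), Continuous φ → Continuous g → (∀ x, |φ x| ≤ 1) → (∃ K : ℝ, ∀ v, |g v| ≤ K) → (∀ (c₀ c₂ : ℝ) (b : Literature.MathematicalPhysics.KineticTheory.V3), ∫ v, g v * (c₀ + inner ℝ b v + c₂ * ‖v‖ ^ 2) ∂(ProbabilityTheory.stdGaussian Literature.MathematicalPhysics.KineticTheory.V3) = 0) → ∀ η : ℝ, 0 < η → ∃ s₀ : ℝ, 0 < s₀ ∧ ∀ s : ℝ, s₀ ≤ s → ∃ σ₀ : ℝ, 0 < σ₀ ∧ ∀ σ : ℝ, 0 < σ → σ < σ₀ → (∀ (N : ℕ) (Φ : Literature.Analysis.FluidPDE.HardSphereFlow (Literature.Analysis.FluidPDE.Torus.geometry (Fin 3)) (Literature.MathematicalPhysics.KineticTheory.hsDiameter σ N) (N + 1)), MeasureTheory.IsProbabilityMeasure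 (Literature.MathematicalPhysics.KineticTheory.localGibbsLaw σ (fun _ => a) (fun _ => u₀) (fun _ => θ) N Φ)) ∧ ∀ (N : ℕ) (Φ : Literature.Analysis.FluidPDE.HardSphereFlow (Literature.Analysis.FluidPDE.Torus.geometry (Fin 3)) (Literature.MathematicalPhysics.KineticTheory.hsDiameter σ N) (N + 1)), (let h : ℝ := s / (σ ^ 2 * Real.sqrt θ) * ((N + 1 : ℕ) : ℝ) ^ (-(1 / 3 : ℝ)); |s * ((∫⁻ z, ENNReal.ofReal ((h⁻¹ * ∫ r in (0 : ℝ)..h, ∑ i, φ (Φ.flow r z i).1 * g ((Real.sqrt θ)⁻¹ • ((Φ.flow r z i).2 - u₀))) ^ 2) ∂(Literature.MathematicalPhysics.KineticTheory.localGibbsLaw σ (fun _ => a) (fun _ => u₀) (fun _ => θ) N Φ)).toReal / (((N : ℝ)) + 1)) - 2 * (∫ x, φ x ^ 2) * Literature.Analysis.UnboundedOperators.dirichletFormInv (Literature.Analysis.UnboundedOperators.hardSphereLinearizedOp (E := Literature.MathematicalPhysics.KineticTheory.V3)) g| ≤ η)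

/-- **THE "FOR EVERY N" STRENGTHENING IS FALSE** (so `N₀` is load-bearing: any proof must let `N → ∞`
before anything else). Witness `N = 0`: one sphere never collides, so for `φ ≡ 1` and the bounded smooth
orthogonal observable `g_B` the kinetic-window functional is the static moment `X = E_{G₀}[g_B(w)²]`,
INDEPENDENT of the window `s`; the statement at `η = D/2`, `D = dirichletFormInv L g_B > 0` (tree:
spectral gap), windows `s₀` and `2s₀` and one common `σ` gives `s₀X ≥ 3D/2` and `2s₀X ≤ 5D/2`, absurd.
[folklore] -/
theorem not_boltzmannGreenKubo_forallN : ¬ BoltzmannGreenKuboForallN := by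
  intro h
  have hD := dirichletFormInv_gB_pos
  set D := dirichletFormInv (hardSphereLinearizedOp (E := V3)) gB with hDdef
  obtain ⟨s₀, hs₀, h2⟩ := h 1 1 0 one_pos one_pos (fun _ => 1) gB continuous_const continuous_gB
    (fun _ => by simp) ⟨1, abs_gB_le⟩ gB_orth (D / 2) (by positivity)
  obtain ⟨σ₁, hσ₁, h3⟩ := h2 s₀ le_rfl
  obtain ⟨σ₂, hσ₂, h3'⟩ := h2 (2 * s₀) (by linarith)
  set σ : ℝ := min (min σ₁ σ₂ / 2) (1 / 4) with hσdef
  have hm : 0 < min σ₁ σ₂ := lt_min hσ₁ hσ₂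
  have hσpos : 0 < σ := lt_min (by linarith) (by norm_num)
  have hσ1 : σ < σ₁ := by
    have a1 : σ ≤ min σ₁ σ₂ / 2 := min_le_left _ _
    have a2 : min σ₁ σ₂ ≤ σ₁ := min_le_left _ _
    linarith
  have hσ2 : σ < σ₂ := by
    have a1 : σ ≤ min σ₁ σ₂ / 2 := min_le_left _ _
    have a2 : min σ₁ σ₂ ≤ σ₂ := min_le_right _ _
    linarith
  have hσle : σ ≤ 1 / 4 := min_le_right _ _
  obtain ⟨-, h4⟩ := h3 σ hσpos hσ1
  obtain ⟨-, h4'⟩ := h3' σ hσpos hσ2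
  have hεpos : 0 < hsDiameter σ 0 := hsDiameter_pos hσpos 0
  have hεlt : hsDiameter σ 0 < 2⁻¹ := by
    have := hsDiameter_le hσpos.le 0
    linarith
  obtain ⟨Φ⟩ := HardSphereFlow.nonempty_torus_holds (d := Fin 3) hεpos hεlt (0 + 1)
  set X : ℝ := (∫⁻ z, ENNReal.ofReal ((∑ i, (1 : ℝ) * gB ((Real.sqrt 1)⁻¹ • ((z i).2 - 0))) ^ 2)
    ∂(localGibbsLaw σ (fun _ => 1) (fun _ => 0) (fun _ => 1) 0 Φ)).toReal with hX
  have hh1 : 0 < s₀ / (σ ^ 2 * Real.sqrt 1) * ((0 + 1 : ℕ) : ℝ) ^ (-(1 / 3 : ℝ)) := by positivity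
  have hh2 : 0 < 2 * s₀ / (σ ^ 2 * Real.sqrt 1) * ((0 + 1 : ℕ) : ℝ) ^ (-(1 / 3 : ℝ)) := by positivity
  have e1 := window_N0 Φ hh1 (fun v => gB ((Real.sqrt 1)⁻¹ • (v - 0)))
  have e2 := window_N0 Φ hh2 (fun v => gB ((Real.sqrt 1)⁻¹ • (v - 0)))
  beta_reduce at e1 e2
  have k1 : |s₀ * (X / (((0 : ℕ) : ℝ) + 1)) - 2 * (∫ x : T3, (1 : ℝ) ^ 2) * D| ≤ D / 2 := by
    rw [hX, ← e1]
    exact h4 0 Φ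
  have k2 : |2 * s₀ * (X / (((0 : ℕ) : ℝ) + 1)) - 2 * (∫ x : T3, (1 : ℝ) ^ 2) * D| ≤ D / 2 := by
    rw [hX, ← e2]
    exact h4' 0 Φ
  have hint1 : ∫ x : T3, (1 : ℝ) ^ 2 = 1 := by simp
  rw [hint1] at k1 k2
  simp only [Nat.cast_zero, zero_add, div_one] at k1 k2
  have e3 : 2 * s₀ * X = 2 * (s₀ * X) := by ring
  rw [e3] at k2
  rw [abs_le] at k1 k2
  linarith [k1.1, k2.2, hD]


end Summit.AtomisticToContinuum.HydrodynamicLimit.Theorems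

end
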